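import Summits.AtomisticToContinuum.HydrodynamicLimit.Theses.InformationPercolationEngine
import Literature.MathematicalPhysics.KineticTheory.HardSphereEulerProofs
import HarnessLib

/-!
# `InformationPercolationEngine.CollisionMomentBound` (stmt-AtomisticToContinuum-15144): the consequence it
# is filed for — uniform integrability of the momentum-transfer mark against the collision functional

Helper file (`--supports stmt-AtomisticToContinuum-15144`).  The route text files `CollisionMomentBound`
(tightness of `K_N[1 + ‖vᵢ‖² + ‖vⱼ‖²]` under local Gibbs data) as the velocity-tail input of the kinetic dock
`ChaosClosesEuler`: "uniform integrability of the momentum-transfer mark `|(v−v*)·ω| ≤ |v−v*|` against `K_N`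
(`K_N[|v−v*|·1_{|v−v*|>L}] ≤ 2K_b/L`) — exactly what lets bounded-mark ContactChaos close the collisional
momentum flux".  This file proves that consequence in the route's typing:

* `speedTail_le` — the pointwise inequality `‖v − w‖ 1{L < ‖v − w‖} ≤ (2/L)(1 + ‖v‖² + ‖w‖²)` (`L > 0`);
* `sum_speedTail_le` — hence, over any finite set of collision times, the ordered-pair collision sum of the
  speed-tail mark is at most `2/L` times that of `1 + ‖vᵢ‖² + ‖vⱼ‖²`;
* `collisionSpeedTailBound_of_collisionMomentBound` — `CollisionMomentBound` implies: with the SAME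
  `σ₀, K_b, N₀`, for every `N ≥ N₀` and every `L > 0`,
  `P_N{2K_b/L < K_N[‖vᵢ − vⱼ‖ 1{L < ‖vᵢ − vⱼ‖}]} ≤ δ` (good orbits have finitely many collision times in
  `[0, τ]`; the complement of the good set is null for the local Gibbs law).

The velocities are read at the collision instant (post-collisional, right-continuous orbit); the marks
`‖vᵢ − vⱼ‖` and `‖vᵢ‖² + ‖vⱼ‖²` are collision invariants, so pre/post is immaterial.
-/

noncomputable section

open MeasureTheory Set Filter Topology
open scoped ENNReal BigOperators

namespace Summit.AtomisticToContinuum.HydrodynamicLimit.Theorems.CollisionMomentBound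

open Literature.Analysis.FluidPDE Literature.MathematicalPhysics.KineticTheory

/-- `‖v − w‖ · 1{L < ‖v − w‖} ≤ (2/L)(1 + ‖v‖² + ‖w‖²)` for `L > 0`
(`‖v − w‖ < ‖v − w‖²/L ≤ 2(‖v‖² + ‖w‖²)/L` on the tail). [folklore] -/
theorem speedTail_le {L : ℝ} (hL : 0 < L) (v w : V3) :
    (if L < ‖v - w‖ then ‖v - w‖ else 0) ≤ 2 / L * (1 + ‖v‖ ^ 2 + ‖w‖ ^ 2) := by
  have hrhs : 0 ≤ 2 / L * (1 + ‖v‖ ^ 2 + ‖w‖ ^ 2) := by positivity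
  split_ifs with h
  · have h1 : ‖v - w‖ ≤ ‖v‖ + ‖w‖ := norm_sub_le v w
    have h2 : ‖v - w‖ * L ≤ ‖v - w‖ ^ 2 := by
      rw [sq]; exact mul_le_mul_of_nonneg_left h.le (norm_nonneg _)
    have h3 : ‖v - w‖ ^ 2 ≤ 2 * (1 + ‖v‖ ^ 2 + ‖w‖ ^ 2) := by
      nlinarith [h1, norm_nonneg (v - w), norm_nonneg v, norm_nonneg w, sq_nonneg (‖v‖ - ‖w‖)]
    rw [div_mul_eq_mul_div, le_div_iff₀ hL]
    linarith
  · exact hrhs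

/-- Over a finite set of collision times, the ordered-pair collision sum of the speed-tail mark is at most
`2/L` times the collision sum of `1 + ‖vᵢ‖² + ‖vⱼ‖²`. [folklore] -/
theorem sum_speedTail_le {n : ℕ} (T : Finset ℝ) (c : ℝ → Fin n → Fin n → Prop) [∀ s i j, Decidable (c s i j)]
    (vel : ℝ → Fin n → V3) {L : ℝ} (hL : 0 < L) :
    ∑ s ∈ T, ∑ i : Fin n, ∑ j : Fin n,
        (if c s i j then (if L < ‖vel s i - vel s j‖ then ‖vel s i - vel s j‖ else 0) else 0) ≤
      2 / L * ∑ s ∈ T, ∑ i : Fin n, ∑ j : Fin n,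
        (if c s i j then 1 + ‖vel s i‖ ^ 2 + ‖vel s j‖ ^ 2 else 0) := by
  rw [Finset.mul_sum]
  refine Finset.sum_le_sum fun s _ => ?_
  rw [Finset.mul_sum]
  refine Finset.sum_le_sum fun i _ => ?_
  rw [Finset.mul_sum]
  refine Finset.sum_le_sum fun j _ => ?_
  by_cases hc : c s i j
  · rw [if_pos hc, if_pos hc]
    exact speedTail_le hL _ _
  · rw [if_neg hc, if_neg hc, mul_zero]

/-- **`CollisionMomentBound` gives the uniform integrability of the momentum-transfer mark against the
collision functional.** If `CollisionMomentBound` holds then, for the same `σ₀`, `K_b`, `N₀`: for all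
`N ≥ N₀` and every `L > 0`, `P_N{2K_b/L < K_N[‖vᵢ − vⱼ‖ 1{L < ‖vᵢ − vⱼ‖}]} ≤ δ`, where
`K_N[F] = ε_N (N+1)⁻¹ Σ_{collision times s ∈ [0,τ]} Σ_{ordered contact pairs (i,j)} F` as in the route decl.
Pathwise on good orbits `K_N[speed tail] ≤ (2/L) K_N[1 + ‖vᵢ‖² + ‖vⱼ‖²]` (`sum_speedTail_le`); the complement of
the good set is null. [folklore] -/
theorem collisionSpeedTailBound_of_collisionMomentBound
    (h : _root_.Summit.AtomisticToContinuum.HydrodynamicLimit.Theses.InformationPercolationEngine.CollisionMomentBound) :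
    ∀ (a₀ θ₀ : T3 → ℝ) (u₀ : T3 → V3), Continuous a₀ → Continuous θ₀ → Continuous u₀ → (∀ x, 0 < a₀ x) →
      (∀ x, 0 < θ₀ x) → ∃ σ₀ : ℝ, 0 < σ₀ ∧ ∀ σ : ℝ, 0 < σ → σ < σ₀ →
      ∀ Φ : (N : ℕ) → HardSphereFlow (Torus.geometry (Fin 3)) (hsDiameter σ N) (N + 1),
      ∀ τ : ℝ, 0 < τ → ∀ δ : ℝ, 0 < δ → ∃ Kb : ℝ, ∃ N₀ : ℕ, ∀ N : ℕ, N₀ ≤ N → ∀ L : ℝ, 0 < L →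
        let ε := hsDiameter σ N
        let G : Geometry (Fin 3) T3 := Torus.geometry (Fin 3)
        let γ : Config (N + 1) (Fin 3) T3 → ℝ → Config (N + 1) (Fin 3) T3 := fun z s => (Φ N).flow s z
        let Kc : (Config (N + 1) (Fin 3) T3 → ℝ → Fin (N + 1) → Fin (N + 1) → ℝ) →
            Config (N + 1) (Fin 3) T3 → ℝ := fun F z => ε / (N + 1 : ℝ) *
          ∑ᶠ (s : ℝ) (_ : s ∈ collisionTimes G ε (γ z) ∩ Set.Icc 0 τ),
            ∑ i : Fin (N + 1), ∑ j : Fin (N + 1),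
              (if i ≠ j ∧ ‖G.sepVec (γ z s i).1 (γ z s j).1‖ = ε then F z s i j else 0)
        localGibbsLaw σ a₀ u₀ θ₀ N (Φ N)
            {z | 2 * Kb / L < Kc (fun z s i j =>
              if L < ‖(γ z s i).2 - (γ z s j).2‖ then ‖(γ z s i).2 - (γ z s j).2‖ else 0) z} ≤
          ENNReal.ofReal δ := by
  intro a₀ θ₀ u₀ ha hθ hu ha0 hθ0
  obtain ⟨σ₀, hσ₀, H⟩ := h a₀ θ₀ u₀ ha hθ hu ha0 hθ0
  refine ⟨σ₀, hσ₀, fun σ hσ hσlt Φ τ hτ δ hδ => ?_⟩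
  obtain ⟨Kb, N₀, hK⟩ := H σ hσ hσlt Φ τ hτ δ hδ
  refine ⟨Kb, N₀, fun N hN L hL => ?_⟩
  have hK' := hK N hN
  simp only [] at hK' ⊢
  have hgood0 : localGibbsLaw σ a₀ u₀ θ₀ N (Φ N) (Φ N).goodᶜ = 0 := by
    rw [localGibbsLaw_eq]
    exact localGibbsMeasure_absolutelyContinuous σ _ _ _ N (Φ N) (Φ N).measure_compl_good
  refine le_trans (measure_mono fun z hz => ?_)
    (((measure_union_le _ _).trans (add_le_add (le_of_eq hgood0) hK')).trans_eq (zero_add _))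
  by_cases hgood : z ∈ (Φ N).good
  · refine Or.inr ?_
    have hfin := ((Φ N).isTrajectory z hgood).locFinite 0 τ
    have hε : 0 ≤ hsDiameter σ N / (N + 1 : ℝ) := div_nonneg (hsDiameter_pos hσ N).le (by positivity)
    have hz' := hz
    rw [mem_setOf_eq, finsum_mem_eq_finite_toFinset_sum _ hfin] at hz'
    show Kb < _
    rw [finsum_mem_eq_finite_toFinset_sum _ hfin]
    have hle := sum_speedTail_le hfin.toFinset
      (fun s i j => i ≠ j ∧ ‖(Torus.geometry (Fin 3)).sepVec ((Φ N).flow s z i).1 ((Φ N).flow s z j).1‖ =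
        hsDiameter σ N)
      (fun s i => ((Φ N).flow s z i).2) hL
    have h2 : 2 * Kb / L < 2 / L * (hsDiameter σ N / (N + 1 : ℝ) *
        ∑ s ∈ hfin.toFinset, ∑ i : Fin (N + 1), ∑ j : Fin (N + 1),
          (if i ≠ j ∧ ‖(Torus.geometry (Fin 3)).sepVec ((Φ N).flow s z i).1 ((Φ N).flow s z j).1‖ =
              hsDiameter σ N then 1 + ‖((Φ N).flow s z i).2‖ ^ 2 + ‖((Φ N).flow s z j).2‖ ^ 2 else 0)) := by
      refine lt_of_lt_of_le hz' ?_
      rw [mul_left_comm]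
      exact mul_le_mul_of_nonneg_left hle hε
    have h2L : 0 < 2 / L := by positivity
    rw [show 2 * Kb / L = 2 / L * Kb by ring] at h2
    exact lt_of_mul_lt_mul_left h2 h2L.le
  · exact Or.inl hgood

end Summit.AtomisticToContinuum.HydrodynamicLimit.Theorems.CollisionMomentBound

end
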